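import Summits.HodgeConjecture.HodgeConjecture.Theorems.F0P3cStCharTSFinOfL2            -- ★ p848594 K4 «FIN-OF-L2» (→ ★ K1∕K2 «SC-FIN»∕«L2-FIN», ★ «ELL-LIN», ★ «BESSEL-FIN», ★ carpets)
import Summits.HodgeConjecture.HodgeConjecture.Theorems.F0P3cStCharTSUpPseudo           -- ★ p848578 K1b «UP-PSEUDO» + ★ ED. 2 p852423 (D4-1) `packetTrace_transfer_eq_innerG_up_LB` (`UpSpecLB`)
import Literature.NumberTheory.Rogawski1990.Ch12Sec5                                   -- ★ TR carpet relations
import Literature.NumberTheory.Rogawski1990.Ch12Sec6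
import Literature.NumberTheory.Rogawski1990.CMCharIdentityClauses                     -- ★ organ vocabulary: `OneDimAutRepH`, `xiLocalChar`, `Gqs`, `qsForm`, `charDist`
import Literature.NumberTheory.Rogawski1990.LocalTransferExistence                     -- ★ `IsLocalDeltaTransferExists` ((T_v)), `IsLocalDeltaTransfer`
import Literature.NumberTheory.Rogawski1990.FinExplicitTransferFactorConjRight         -- ★ `finExplicitCollection`, `finExplicitDelta_conj_left_all∕right_all` (Δ‴_{Φ₃} of record)
import Literature.NumberTheory.Automorphic.OrbitalMeasureCanonical                     -- ★ `OrbitalMeasureFamily.IsCanonical`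
import Literature.NumberTheory.Automorphic.UnitaryGroupPrincipalSeriesH                -- ★ `HLengthTwoLabels`
import Literature.NumberTheory.Automorphic.IrreducibleClassesUnitarizable              -- ★ `IrrClass.IsUnitarizable`, `IrrClass.IsSquareIntegrable`
import Summits.HodgeConjecture.HodgeConjecture.Theorems.F0P3cStCharTSFinOfL2Pseudo      -- ★ p848864 K4′ (b finite from the regrouped identity)
import Summits.HodgeConjecture.HodgeConjecture.Theorems.F0P3cStCharTSSaTorusGeneric    -- ★ p848847 (F) generic `false_of_ps_expansion`
import Literature.NumberTheory.Automorphic.UnitaryGroupPrincipalSeriesExponents     -- ★ `conjInvChar` (the W-action on χ₁), `cmWeylTorusCharPair`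
import Literature.NumberTheory.Automorphic.UnitaryGroupBorelInduction               -- ★ `cmPrincipalSeries`, `cmTorusCharPair`, `normOneUnits`, `conjLocal_conjLocal_cm`
import Literature.NumberTheory.Rogawski1990.Ch12Sec5UpSpecLB                             -- ★ (D4-def) p852414: `Ch12Sec5.EllipticData.UpSpecLB`
import HarnessLib

/-!
# `_LB` TWIN (ROAD «UP-TR» D1′, DEAL #4 (D4-2), 2026-09-02): this file is ★ `Theorems/F0P3cStCharTSSaTorus.lean` with `𝔇.UpSpec ↦ 𝔇.UpSpecLB` + ONE threaded binder `hρB`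

Seat LH4-p03 (g9); holder F0P3-p02 (g23) DEAL #4 18:54:52Z ∕ 19:00:57Z; LEAD F0P3a-plan (g15) T14-26 (W1)–(W3); desk D1′ guards (α)–(δ).  The theorem
`false_of_saRegroup_disjunct_LB` below is the STATEMENT and PROOF of ★ `…F0P3cStCharTSSaTorus.false_of_saRegroup_disjunct` BYTE-COPIED with exactly these edits: (i) the carpet binder `𝔇.UpSpec →` ↦
`𝔇.UpSpecLB →` (★ (D4-def) p852414 `Literature/NumberTheory/Rogawski1990/Ch12Sec5UpSpecLB`: clause 3 of print's `α ↦ α^G` [§12.5 p. 183] under the locally-bounded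
antecedent `∀ C compact, ∃ B, ‖D_H(s) α(s)‖ ≤ B on C ∩ H^r`); (ii) immediately after it the FIXED-PACKET binder in `regH` currency `(∀ C, IsCompact C → ∃ B, ∀ s ∈ C, s ∈ 𝔇.regH → ‖(𝔇.DH s : ℂ) * 𝔇.packetCharH {πSt} s‖ ≤ B) →
-- hρB` = the `hρB` of ★ ED. 2 p852423 (D4-1) at `ρ = {πSt}` (the caller (D4-3) `SaHeadLB` passes `hHBHr _ hρ` from its ρ-generic `hHBHr`, F0P2-p02 (g22) CERT 990cf6a1 :163∕:704;
the junction (D4-7) discharges `hHBHr` ONCE from the leaf's ★ `hHBHP` pin + ★ `hRegH` — no new outer input, guard (α)); (iii) the single pass-through call :208 of ★ UpPseudo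
`packetTrace_transfer_eq_innerG_up` ↦ ★ ED. 2 p852423 (D4-1) `packetTrace_transfer_eq_innerG_up_LB … hρtr hρB hUli …`.  The ★ original is UNTOUCHED (guard γ); this is a
new sibling module because an append-only ED. would exceed 400 lines.  Everything below this block is the ★ file's own documentation, valid verbatim for the twin.
HONEST LABEL: count-neutral; «UP clause re-lettered to the locally-bounded reading of Rogawski p. 183 (true at every `α = packetCharH ρ` via ★ hHBHP); print's general-α
clause 3 is NOT claimed in house»; HC_CM is proved only modulo the 7 printed citations (2 remaining: hLiu418 = `stmt-HodgeConjecture-24832`, h413 = `stmt-HodgeConjecture-24833`)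
until rung 0 closes.
-/

/-!
# F0 · P3c · line LH6 «StCharTS» — «Sa-TORUS★» F3 (organ level): THE SECOND DISJUNCT OF (R) IS IMPOSSIBLE at the (S-a) organ's literal binders —
# print's split-torus Fourier step [Rogawski1990, L. 12.7.2 proof pp. 193–194] on `M = E_vˣ × E¹_v`, read through the TR carpets + named sockets

Cell `pub/hodgecm-mathlib`, crux H413 = `stmt-HodgeConjecture-24833` (`--supports` lane, helper), route HCCMUnconditional; seat LH6-p05 (g0); desk F0P3b-plan (g23) deals
«Sa-COMPOSE★» 03:07:39Z and «=» 03:21:49Z (the (S-a) head = ⟨LH6-p01's «Sa-L2★» `sa_sqInt_of_carpet` (second conjunct), this file (first conjunct from the second)⟩).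
THEOREMS ONLY, sorry-free, no definition ∕ instance ∕ notation ∕ Lines import; the datum is a BINDER; nothing about `U(3)` is asserted beyond the organ's own hypotheses.
HONEST LABEL: HC_CM is proved only modulo the 7 printed citations (2 remaining: hLiu418 = stmt-HodgeConjecture-24832, h413 = stmt-HodgeConjecture-24833) until rung 0
closes; count-neutral — (S-a) stays a printed row of the leaf `Cruxes/H413/Lines/F0_P3c_StCharTSPaydown.lean` ED. 1 (:158).

THE STATEMENT `false_of_saRegroup_disjunct`: binders = (A) the TREE TEXT of `stub_StSupportFiniteSqInt` (ED. 1 :159–183, `Pl`∕`HLoc` unfolded, copied by script) up to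
and including the `μZ` binders — the organ's `aX` and its three clauses are NOT bound here (LH6-p01's (R) `sa_regroup_of_carpet` consumes them and hands out the disjunct
below); (B) LH6-p01's datum block + COMPAT (★ p848567, byte-copied: `𝔇.μG = νQv`, `𝔇.μH = νHv`, `𝔇.μGZ = μZ`, `IsTransfer ↔ IsLocalDeltaTransfer … Δ‴_{Φ₃} …`,
`{πSt} ∈ Π²(H)`), the CARPET relations (★ names) and the SOCKETS of ★ «Sa-COMPOSE» p848625 ((M1H)(UPR)(ELL)(DET)(PIN)(LDS)(L2D∀)(U2)(C1)(C2)(C3), texts on the squad bus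
03:31Z–04:05Z); (C) the SECOND DISJUNCT of (R) (interface v2final 5d9fdf194fdb0980) as binders `b d` with its clauses (members of `supp b` square-integrable, W-REDUCED,
(CONT), the regrouped identity on every Δ‴-matched smooth pair with BOTH families summable, `∃ χ₀, d χ₀ ≠ 0`); (D) the socket (PSE) [§12.6 p. 187]; (E) the split torus
`M = E_vˣ × E¹_v` in parameter form `(LocalRing L v)ˣ × normOneUnits σ_v` with the sockets (TOR) (a left-invariant `μM`, the compact part `M_c` measurable ∕ compact ∕ of
finite positive mass, a ray generator `a` with pairwise disjoint shells `aⁿ·M_c` covering `M`, the W-flip `ω = (σ_v(·)⁻¹, id)` a measure-preserving measurable embedding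
mapping `M_c` into itself); (F) posited `F_f : (G → ℂ) → M → ℂ`, `Ω ⊆ G`, the product character `toC` (pinned by `toC χ m = χ₁ m₁ · χ₂ m₂`) and the analytic sockets
(WM∕L2M)(HM)(PSM)(SHF) of print's pp. 193–194 ⊢ `False`.
PROOF = (1) `supp b` is finite: ★ K4′ `F0P3cStCharTSFinOfL2Pseudo.support_finite_of_members_isL2_pseudo` at the datum, its `hup` DISCHARGED by ★ K1b
`F0P3cStCharTSUpPseudo.packetTrace_transfer_eq_innerG_up` (★ `WeylIntegrationFormula` + ★ `UpSpec` + (M1H)(UPR)), the principal-series sum vanishing termwise at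
pseudo-coefficients by (PSE), «pairs have at most one L² member» from (DET)(PIN)(LDS); (2) ★ generic (F) `F0P3cStCharTSSaTorusGeneric.false_of_ps_expansion` on `M` with
`w χ = (conjInvChar σ_v χ₁, χ₂)` (an involution by ★ `conjLocal_conjLocal_cm`, `toC (w χ) = toC χ ∘ ω` by ★ `conjInvChar_apply`), the W-regularity of `supp d` read from
W-REDUCED, and the uniform bound of the characters `toC χ`, `χ ∈ supp d`, on the compact `M_c` from (CONT).
Print: [Rogawski1990, L. 12.7.2 proof pp. 192–194]: «Suppose X′ non-empty … ∫_M F_f(α)(Σ d(τ)(χ_τ(α) + χ_τ(ᾱ⁻¹)) + Θ(α)) dα = 0 … the Fourier transform of an L¹-function …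
contradiction», then «X″ is finite».

## References
* [Rogawski1990] J. D. Rogawski, *Automorphic Representations of Unitary Groups in Three Variables*, Ann. of Math. Stud. 123 (1990): §12.7 Lemma 12.7.2 (proof) pp. 192–194;
  §12.5 pp. 182–184 (Weyl integration, `α^G`, `⟨ , ⟩_e`); §12.6 p. 187, Prop. 12.6.1 p. 188; §12.2 pp. 173–174.
-/

set_option autoImplicit false
-- the mandated namespace has the single-problem summit's repeated segment (`HodgeConjecture.HodgeConjecture`)
set_option linter.dupNamespace false

noncomputable section

open NumberField IsDedekindDomain MeasureTheory MeasureTheory.Measure Filter Topology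
open scoped Matrix MatrixGroups BigOperators Pointwise
open Literature.NumberTheory.Rogawski1990 Literature.NumberTheory.Automorphic Literature.NumberTheory.Automorphic.UnitaryGroup
open Literature.NumberTheory.GaloisRepresentations

namespace Summit.HodgeConjecture.HodgeConjecture.Cruxes.H413.F0P3cStCharTSSaTorusLB

open Literature.NumberTheory.Rogawski1990.Ch12Sec5

set_option maxHeartbeats 4000000 in
/-- **`_LB` TWIN of ★ `F0P3cStCharTSSaTorus.false_of_saRegroup_disjunct`** (`𝔇.UpSpec ↦ 𝔇.UpSpecLB` + `hρB`; call ★ `packetTrace_transfer_eq_innerG_up_LB`).  **«Sa-TORUS★» F3 — the second disjunct of LH6-p01's `sa_regroup_of_carpet` (interface v2final) is impossible, at the (S-a) organ's literal binders.**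
Binders: the organ prefix (VERBATIM), LH6-p01's datum block + COMPAT (★ p848567, byte-copied), the carpet relations and sockets of ★ «Sa-COMPOSE» p848625 (for the finiteness
of `supp b` via ★ K4′ + (PSE)), the disjunct's conjuncts as binders (verbatim shapes of interface v2final: L² members, W-REDUCED, (CONT), the identity with both families
summable), the split torus `M = E_vˣ × E¹_v` with sockets (TOR), and the analytic sockets (WM∕L2M)(HM)(PSM)(SHF) of print's pp. 193–194 over posited `F_f` and `Ω`.
Proof = ★ generic `F0P3cStCharTSSaTorusGeneric.false_of_ps_expansion`. [cite: Rogawski1990, §12.7 Lemma 12.7.2 (proof) pp. 192–194; §12.5 p. 182; §12.6 p. 187] -/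
theorem false_of_saRegroup_disjunct_LB :
  ∀ (L : Type) [Field L] [NumberField L] [IsCMField L] (μ : HeckeCharacter L) (ξ : OneDimAutRepH L) (v : HeightOneSpectrum (𝓞 ↥(maximalRealSubfield L))),
    (∀ w : PlacesOver L v, IsCMField.complexConj L • w.1 = w.1) → μ.IsUnitary →
    (∀ x : Literature.NumberTheory.GaloisRepresentations.ideleGroup ↥(maximalRealSubfield L),
      μ (AdeleRing.ideleBaseChange (↥(maximalRealSubfield L)) L x) = quadraticHeckeCharCM L x) →
    ∀ [MeasurableSpace ((UnitaryGroup.cmDatum L 2 (Matrix.of fun i j : Fin 2 => if i.val + j.val + 1 = 2 then (1 : L) else 0)).Local v × (UnitaryGroup.cmDatum L 1 (Matrix.of fun i j : Fin 1 => if i.val + j.val + 1 = 1 then (1 : L) else 0)).Local v)] [BorelSpace ((UnitaryGroup.cmDatum L 2 (Matrix.of fun i j : Fin 2 => if i.val + j.val + 1 = 2 then (1 : L) else 0)).Local v × (UnitaryGroup.cmDatum L 1 (Matrix.of fun i j : Fin 1 => if i.val + j.val + 1 = 1 then (1 : L) else 0)).Local v)] [MeasurableSpace (Gqs L v)] [BorelSpace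 (Gqs L v)]
      (νHv : Measure ((UnitaryGroup.cmDatum L 2 (Matrix.of fun i j : Fin 2 => if i.val + j.val + 1 = 2 then (1 : L) else 0)).Local v × (UnitaryGroup.cmDatum L 1 (Matrix.of fun i j : Fin 1 => if i.val + j.val + 1 = 1 then (1 : L) else 0)).Local v)) (νQv : Measure (Gqs L v))
      [νHv.IsHaarMeasure] [νHv.IsMulRightInvariant] [νQv.IsHaarMeasure] [νQv.IsMulRightInvariant],
    letI : ∀ a : ((UnitaryGroup.cmDatum L 2 (Matrix.of fun i j : Fin 2 => if i.val + j.val + 1 = 2 then (1 : L) else 0)).Local v × (UnitaryGroup.cmDatum L 1 (Matrix.of fun i j : Fin 1 => if i.val + j.val + 1 = 1 then (1 : L) else 0)).Local v), MeasurableSpace (((UnitaryGroup.cmDatum L 2 (Matrix.of fun i j : Fin 2 => if i.val + j.val + 1 = 2 then (1 : L) else 0)).Local v × (UnitaryGroup.cmDatum L 1 (Matrix.of fun i j : Fin 1 => if i.val + j.val + 1 = 1 then (1 : L) else 0)).Local v) ⧸ Subgroup.centralizer ({a} : Set ((UnitaryGroup.cmDatum L 2 (Matrix.of fun i j : Fin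 2 => if i.val + j.val + 1 = 2 then (1 : L) else 0)).Local v × (UnitaryGroup.cmDatum L 1 (Matrix.of fun i j : Fin 1 => if i.val + j.val + 1 = 1 then (1 : L) else 0)).Local v))) := fun _ => borel _
    haveI : ∀ a : ((UnitaryGroup.cmDatum L 2 (Matrix.of fun i j : Fin 2 => if i.val + j.val + 1 = 2 then (1 : L) else 0)).Local v × (UnitaryGroup.cmDatum L 1 (Matrix.of fun i j : Fin 1 => if i.val + j.val + 1 = 1 then (1 : L) else 0)).Local v), BorelSpace (((UnitaryGroup.cmDatum L 2 (Matrix.of fun i j : Fin 2 => if i.val + j.val + 1 = 2 then (1 : L) else 0)).Local v × (UnitaryGroup.cmDatum L 1 (Matrix.of fun i j : Fin 1 => if i.val + j.val + 1 = 1 then (1 : L) else 0)).Local v) ⧸ Subgroup.centralizer ({a} : Set ((UnitaryGroup.cmDatum L 2 (Matrix.of fun i j : Fin 2 => if i.val + j.val + 1 = 2 then (1 : L) else 0)).Local v × (UnitaryGroup.cmDatum L 1 (Matrix.of fun i j : Fin 1 => if i.val + j.val + 1 = 1 then (1 : L) else 0)).Local v))) := fun _ => ⟨rfl⟩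
    letI : ∀ γ : Gqs L v, MeasurableSpace (Gqs L v ⧸ Subgroup.centralizer ({γ} : Set (Gqs L v))) := fun _ => borel _
    haveI : ∀ γ : Gqs L v, BorelSpace (Gqs L v ⧸ Subgroup.centralizer ({γ} : Set (Gqs L v))) := fun _ => ⟨rfl⟩
    ∀ (mHv : OrbitalMeasureFamily ((UnitaryGroup.cmDatum L 2 (Matrix.of fun i j : Fin 2 => if i.val + j.val + 1 = 2 then (1 : L) else 0)).Local v × (UnitaryGroup.cmDatum L 1 (Matrix.of fun i j : Fin 1 => if i.val + j.val + 1 = 1 then (1 : L) else 0)).Local v)) (mQv : OrbitalMeasureFamily (Gqs L v)),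
      mHv.IsCanonical (IsLocalGRegular L v) νHv →
      mQv.IsCanonical (fun γ => IsRegularElt (γ.val : GL (Fin 3) (UnitaryGroup.LocalRing L v))) νQv →
      IsLocalDeltaTransferExists L (qsForm L) v ((finExplicitCollection L (qsForm L) μ (finExplicitDelta_conj_left_all L (qsForm L) μ) (finExplicitDelta_conj_right_all L (qsForm L) μ)) v) mHv mQv IsLocSmooth IsLocSmooth →
      ∀ (π₁ πSt : IrrClass ((UnitaryGroup.cmDatum L 2 (Matrix.of fun i j : Fin 2 => if i.val + j.val + 1 = 2 then (1 : L) else 0)).Local v × (UnitaryGroup.cmDatum L 1 (Matrix.of fun i j : Fin 1 => if i.val + j.val + 1 = 1 then (1 : L) else 0)).Local v)),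
        HLengthTwoLabels L v
          (torusCharPair (conjLocal L (IsCMField.complexConj L) v) (cmLocalForm L 2 v) (cmLocalForm_eq_over L 2 v) 0
            ((torusLocalComponent L (IsCMField.complexConj L) v ξ.η).comp
                (quotConj (conjLocal L (IsCMField.complexConj L) v) (conjLocal_conjLocal_cm L v)) *
              halfModulusChar (UnitaryGroup.LocalRing L v))
            (torusLocalComponent L (IsCMField.complexConj L) v ξ.ψ))
          ((torusLocalComponent L (IsCMField.complexConj L) v ξ.ψ).comp (localDet (IsCMField.complexConj L) v (isUnit_antidiagOne_det L 1))) π₁ πSt →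
        (∀ fH : ((UnitaryGroup.cmDatum L 2 (Matrix.of fun i j : Fin 2 => if i.val + j.val + 1 = 2 then (1 : L) else 0)).Local v × (UnitaryGroup.cmDatum L 1 (Matrix.of fun i j : Fin 1 => if i.val + j.val + 1 = 1 then (1 : L) else 0)).Local v) → ℂ, IsLocSmooth fH → π₁.smoothTrace νHv fH = charDist (ξ.xiLocalChar v) νHv fH) →
      ∀ [MeasurableSpace (Gqs L v ⧸ Subgroup.center (Gqs L v))] [BorelSpace (Gqs L v ⧸ Subgroup.center (Gqs L v))]
        (μZ : Measure (Gqs L v ⧸ Subgroup.center (Gqs L v))) [μZ.IsHaarMeasure],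
      -- ══ the §12.5–12.6 DATUM on the model (★ TR carpet `Ch12Sec5Defs.EllipticData`, a BINDER — no instance) and its COMPATIBILITY with the organ's currency ══
      ∀ (𝔇 : Ch12Sec5.EllipticData (Gqs L v) ((UnitaryGroup.cmDatum L 2 (Matrix.of fun i j : Fin 2 => if i.val + j.val + 1 = 2 then (1 : L) else 0)).Local v × (UnitaryGroup.cmDatum L 1 (Matrix.of fun i j : Fin 1 => if i.val + j.val + 1 = 1 then (1 : L) else 0)).Local v)),
      𝔇.μG = νQv → 𝔇.μH = νHv → 𝔇.μGZ = μZ →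
      (∀ (φ : Gqs L v → ℂ) (fH : ((UnitaryGroup.cmDatum L 2 (Matrix.of fun i j : Fin 2 => if i.val + j.val + 1 = 2 then (1 : L) else 0)).Local v × (UnitaryGroup.cmDatum L 1 (Matrix.of fun i j : Fin 1 => if i.val + j.val + 1 = 1 then (1 : L) else 0)).Local v) → ℂ), 𝔇.IsTransfer φ fH ↔ IsLocalDeltaTransfer L (qsForm L) v ((finExplicitCollection L (qsForm L) μ (finExplicitDelta_conj_left_all L (qsForm L) μ) (finExplicitDelta_conj_right_all L (qsForm L) μ)) v) mHv mQv fH φ) →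
      ({πSt} : Finset (IrrClass ((UnitaryGroup.cmDatum L 2 (Matrix.of fun i j : Fin 2 => if i.val + j.val + 1 = 2 then (1 : L) else 0)).Local v × (UnitaryGroup.cmDatum L 1 (Matrix.of fun i j : Fin 1 => if i.val + j.val + 1 = 1 then (1 : L) else 0)).Local v))) ∈ 𝔇.sqPacketsH →
      -- ══ CARPET RELATIONS (named facts of ★ `Ch12Sec5` ∕ ★ `Ch12Sec6`, read at `𝔇`) ══
      𝔇.WeylIntegrationFormula → 𝔇.UpSpecLB →
      (∀ C : Set ((UnitaryGroup.cmDatum L 2 (Matrix.of fun i j : Fin 2 => if i.val + j.val + 1 = 2 then (1 : L) else 0)).Local v × (UnitaryGroup.cmDatum L 1 (Matrix.of fun i j : Fin 1 => if i.val + j.val + 1 = 1 then (1 : L) else 0)).Local v), IsCompact C → ∃ B : ℝ, ∀ s ∈ C, s ∈ 𝔇.regH → ‖(𝔇.DH s : ℂ) * 𝔇.packetCharH {πSt} s‖ ≤ B) →  -- hρB (fixed packet)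
      Ch12Sec6.PseudoCoeffExists 𝔇 → Ch12Sec6.PseudoCoeffTrace 𝔇 →
      Ch12Sec6.Prop1261a 𝔇 → Ch12Sec6.Prop1261b 𝔇 → Ch12Sec6.Prop1261c 𝔇 →
      -- ══ PRINTED INPUTS NO CARPET STATES YET, in the socket shapes of LH6-p01's `Ch12Sec5Inputs` draft: (M1H) `PacketCharRegular`, (UPR) `UpRegular`, (ELL) `EllipticOfL2`,
      --    (DET) `DetNotL2`, (PIN) `PiNNotL2`, (LDS) `LdsNotL2`; and FIVE new sockets for the §12.7 (b)-row: (L2D∀) `D_G·χ_π ∈ L²(T)` for EVERY class, (U2) `D_G·χ_ρ^G ∈ L²(T)`,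
      --    (C1) `cartanG ⊆ cartanAll`, (C2) elliptic representatives a.e. in `G^e`, (C3) the other representatives a.e. in `G^r ∖ G^e` ══
      (∀ ρ ∈ 𝔇.sqPacketsH, Measurable (𝔇.packetCharH ρ) ∧ LocallyIntegrable (𝔇.packetCharH ρ) 𝔇.μH ∧
          Ch12Sec5.IsStableClassFunOn 𝔇.stConjH 𝔇.regH (𝔇.packetCharH ρ) ∧ Ch12Sec5.IsStableClassFunOn 𝔇.stConjH 𝔇.ellH (𝔇.packetCharH ρ) ∧
          ∀ fH : ((UnitaryGroup.cmDatum L 2 (Matrix.of fun i j : Fin 2 => if i.val + j.val + 1 = 2 then (1 : L) else 0)).Local v × (UnitaryGroup.cmDatum L 1 (Matrix.of fun i j : Fin 1 => if i.val + j.val + 1 = 1 then (1 : L) else 0)).Local v) → ℂ, IsLocSmooth fH → (∑ σ ∈ ρ, σ.smoothTrace 𝔇.μH fH) = ∫ h, fH h * 𝔇.packetCharH ρ h ∂𝔇.μH) →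
      (∀ ρ ∈ 𝔇.sqPacketsH, LocallyIntegrable (𝔇.up (𝔇.packetCharH ρ)) 𝔇.μG ∧
          ∀ x ∈ 𝔇.regG, ∀ᶠ y in 𝓝 x, 𝔇.up (𝔇.packetCharH ρ) y = 𝔇.up (𝔇.packetCharH ρ) x) →
      (∀ π : IrrClass (Gqs L v), 𝔇.IsL2 π → 𝔇.IsEllipticRep π) →
      (∀ ψ : ↥(Subgroup.center (Gqs L v)) →* ℂˣ, Continuous ψ → ¬ 𝔇.IsL2 (𝔇.detG ψ)) →
      (∀ ξ' : ((UnitaryGroup.cmDatum L 2 (Matrix.of fun i j : Fin 2 => if i.val + j.val + 1 = 2 then (1 : L) else 0)).Local v × (UnitaryGroup.cmDatum L 1 (Matrix.of fun i j : Fin 1 => if i.val + j.val + 1 = 1 then (1 : L) else 0)).Local v) →* ℂˣ, Continuous ξ' → ¬ 𝔇.IsL2 (𝔇.piN ξ')) →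
      (∀ P ∈ 𝔇.ldsPackets, ∀ σ ∈ P, ¬ 𝔇.IsL2 σ) →
      (∀ π : IrrClass (Gqs L v), ∀ T ∈ 𝔇.cartanG, MemLp (fun t : ↥T => (𝔇.DG (t : Gqs L v) : ℂ) * 𝔇.char π (t : Gqs L v)) 2 (𝔇.μT T)) →
      (∀ ρ ∈ 𝔇.sqPacketsH, ∀ T ∈ 𝔇.cartanG, MemLp (fun t : ↥T => (𝔇.DG (t : Gqs L v) : ℂ) * 𝔇.up (𝔇.packetCharH ρ) (t : Gqs L v)) 2 (𝔇.μT T)) →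
      𝔇.cartanG ⊆ 𝔇.cartanAll →
      (∀ T ∈ 𝔇.cartanG, ∀ᵐ t : ↥T ∂(𝔇.μT T), (t : Gqs L v) ∈ 𝔇.ellG) →
      (∀ T ∈ 𝔇.cartanAll, T ∉ 𝔇.cartanG → ∀ᵐ t : ↥T ∂(𝔇.μT T), (t : Gqs L v) ∈ 𝔇.regG ∧ (t : Gqs L v) ∉ 𝔇.ellG) →
      -- ══ the SECOND DISJUNCT of (R) `sa_regroup_of_carpet` (LH6-p01 interface v2final 5d9fdf194fdb0980), its conjuncts as binders ══
      ∀ (b : IrrClass (Gqs L v) → ℤ) (d : (((UnitaryGroup.LocalRing L v)ˣ →* ℂˣ) × (↥(normOneUnits (conjLocal L (IsCMField.complexConj L) v)) →* ℂˣ)) → ℤ),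
        (∀ π : IrrClass (Gqs L v), b π ≠ 0 → π.IsSquareIntegrable μZ) →
        (∀ χ χ' : (((UnitaryGroup.LocalRing L v)ˣ →* ℂˣ) × (↥(normOneUnits (conjLocal L (IsCMField.complexConj L) v)) →* ℂˣ)), d χ ≠ 0 → d χ' ≠ 0 → χ'.2 = χ.2 →
          χ'.1 = conjInvChar (conjLocal L (IsCMField.complexConj L) v) χ.1 → χ' = χ) →
        (∀ χ : (((UnitaryGroup.LocalRing L v)ˣ →* ℂˣ) × (↥(normOneUnits (conjLocal L (IsCMField.complexConj L) v)) →* ℂˣ)), d χ ≠ 0 → Continuous χ.1 ∧ Continuous χ.2) →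
        (∀ (fH : ((UnitaryGroup.cmDatum L 2 (Matrix.of fun i j : Fin 2 => if i.val + j.val + 1 = 2 then (1 : L) else 0)).Local v × (UnitaryGroup.cmDatum L 1 (Matrix.of fun i j : Fin 1 => if i.val + j.val + 1 = 1 then (1 : L) else 0)).Local v) → ℂ) (φ : Gqs L v → ℂ), IsLocSmooth fH → IsLocSmooth φ →
          IsLocalDeltaTransfer L (qsForm L) v ((finExplicitCollection L (qsForm L) μ (finExplicitDelta_conj_left_all L (qsForm L) μ) (finExplicitDelta_conj_right_all L (qsForm L) μ)) v) mHv mQv fH φ →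
          Summable (fun π : IrrClass (Gqs L v) => (b π : ℂ) * π.smoothTrace νQv φ) ∧
          Summable (fun χ : (((UnitaryGroup.LocalRing L v)ˣ →* ℂˣ) × (↥(normOneUnits (conjLocal L (IsCMField.complexConj L) v)) →* ℂˣ)) => (d χ : ℂ) * Representation.smoothTrace (G := Gqs L v) (UnitaryGroup.cmPrincipalSeries L 3 v (UnitaryGroup.cmTorusCharPair L v χ.1 χ.2)) νQv φ) ∧
          ∑' π : IrrClass (Gqs L v), (b π : ℂ) * π.smoothTrace νQv φ + ∑' χ : (((UnitaryGroup.LocalRing L v)ˣ →* ℂˣ) × (↥(normOneUnits (conjLocal L (IsCMField.complexConj L) v)) →* ℂˣ)), (d χ : ℂ) * Representation.smoothTrace (G := Gqs L v) (UnitaryGroup.cmPrincipalSeries L 3 v (UnitaryGroup.cmTorusCharPair L v χ.1 χ.2)) νQv φ = πSt.smoothTrace νHv fH) →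
        (∃ χ₀ : (((UnitaryGroup.LocalRing L v)ˣ →* ℂˣ) × (↥(normOneUnits (conjLocal L (IsCMField.complexConj L) v)) →* ℂˣ)), d χ₀ ≠ 0) →
      -- ══ (PSE) principal-series characters vanish against pseudo-coefficients of square-integrable classes [§12.6 p. 187] ══
      (∀ (π : IrrClass (Gqs L v)) (f : Gqs L v → ℂ), 𝔇.IsL2 π → 𝔇.IsPseudoCoeff π f → ∀ χ : (((UnitaryGroup.LocalRing L v)ˣ →* ℂˣ) × (↥(normOneUnits (conjLocal L (IsCMField.complexConj L) v)) →* ℂˣ)), d χ ≠ 0 → Representation.smoothTrace (G := Gqs L v) (UnitaryGroup.cmPrincipalSeries L 3 v (UnitaryGroup.cmTorusCharPair L v χ.1 χ.2)) νQv f = 0) →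
      -- ══ THE SPLIT TORUS in parameter form `M = E_vˣ × E¹_v` (sockets (TOR): measurable structure, a left-invariant measure, the compact part `M_c = 𝒪ˣ × E¹`,
      --    the ray generator `a = (ϖ, 1)`: `M = M_c·a^ℤ` with pairwise disjoint shells; the W-reflection `ω = (σ(·)⁻¹, id)` preserves the measure and `M_c`) ══
      ∀ [MeasurableSpace ((UnitaryGroup.LocalRing L v)ˣ × ↥(normOneUnits (conjLocal L (IsCMField.complexConj L) v)))] [MeasurableMul ((UnitaryGroup.LocalRing L v)ˣ × ↥(normOneUnits (conjLocal L (IsCMField.complexConj L) v)))] [OpensMeasurableSpace ((UnitaryGroup.LocalRing L v)ˣ × ↥(normOneUnits (conjLocal L (IsCMField.complexConj L) v)))]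
        (μM : Measure ((UnitaryGroup.LocalRing L v)ˣ × ↥(normOneUnits (conjLocal L (IsCMField.complexConj L) v)))) [μM.IsMulLeftInvariant]
        (Mc : Subgroup ((UnitaryGroup.LocalRing L v)ˣ × ↥(normOneUnits (conjLocal L (IsCMField.complexConj L) v)))) (a : ((UnitaryGroup.LocalRing L v)ˣ × ↥(normOneUnits (conjLocal L (IsCMField.complexConj L) v)))),
        MeasurableSet (Mc : Set ((UnitaryGroup.LocalRing L v)ˣ × ↥(normOneUnits (conjLocal L (IsCMField.complexConj L) v)))) → IsCompact (Mc : Set ((UnitaryGroup.LocalRing L v)ˣ × ↥(normOneUnits (conjLocal L (IsCMField.complexConj L) v)))) → μM (Mc : Set ((UnitaryGroup.LocalRing L v)ˣ × ↥(normOneUnits (conjLocal L (IsCMField.complexConj L) v)))) < ⊤ → 0 < μM.real (Mc : Set ((UnitaryGroup.LocalRing L v)ˣ × ↥(normOneUnits (conjLocal L (IsCMField.complexConj L) v)))) →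
        Pairwise (Function.onFun Disjoint fun n : ℤ => (a ^ n) • (Mc : Set ((UnitaryGroup.LocalRing L v)ˣ × ↥(normOneUnits (conjLocal L (IsCMField.complexConj L) v))))) →
        (∀ m : ((UnitaryGroup.LocalRing L v)ˣ × ↥(normOneUnits (conjLocal L (IsCMField.complexConj L) v))), ∃ (n : ℤ) (u : ((UnitaryGroup.LocalRing L v)ˣ × ↥(normOneUnits (conjLocal L (IsCMField.complexConj L) v)))), u ∈ Mc ∧ m = a ^ n * u) →
        MeasurePreserving (fun p : ((UnitaryGroup.LocalRing L v)ˣ × ↥(normOneUnits (conjLocal L (IsCMField.complexConj L) v))) => ((Units.map ((conjLocal L (IsCMField.complexConj L) v : UnitaryGroup.LocalRing L v →+* UnitaryGroup.LocalRing L v) : UnitaryGroup.LocalRing L v →* UnitaryGroup.LocalRing L v) p.1)⁻¹, p.2)) μM μM →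
        MeasurableEmbedding (fun p : ((UnitaryGroup.LocalRing L v)ˣ × ↥(normOneUnits (conjLocal L (IsCMField.complexConj L) v))) => ((Units.map ((conjLocal L (IsCMField.complexConj L) v : UnitaryGroup.LocalRing L v →+* UnitaryGroup.LocalRing L v) : UnitaryGroup.LocalRing L v →* UnitaryGroup.LocalRing L v) p.1)⁻¹, p.2)) →
        (∀ u ∈ Mc, ((Units.map ((conjLocal L (IsCMField.complexConj L) v : UnitaryGroup.LocalRing L v →+* UnitaryGroup.LocalRing L v) : UnitaryGroup.LocalRing L v →* UnitaryGroup.LocalRing L v) u.1)⁻¹, u.2) ∈ Mc) →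
      -- ══ the torus transform `F_f` (print p. 193) and the regular hyperbolic set `Ω = G·M^reg` (posited data; their meaning is carried by the sockets below) ══
      ∀ (Ftr : (Gqs L v → ℂ) → ((UnitaryGroup.LocalRing L v)ˣ × ↥(normOneUnits (conjLocal L (IsCMField.complexConj L) v))) → ℂ) (Ω : Set (Gqs L v)),
      -- the product character of a parameter `χ = (χ₁, χ₂)` on `M = E_vˣ × E¹_v` (posited as a function, pinned by the next hypothesis)
      ∀ (toC : (((UnitaryGroup.LocalRing L v)ˣ →* ℂˣ) × (↥(normOneUnits (conjLocal L (IsCMField.complexConj L) v)) →* ℂˣ)) → (((UnitaryGroup.LocalRing L v)ˣ × ↥(normOneUnits (conjLocal L (IsCMField.complexConj L) v))) →* ℂˣ)),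
      (∀ (χ : (((UnitaryGroup.LocalRing L v)ˣ →* ℂˣ) × (↥(normOneUnits (conjLocal L (IsCMField.complexConj L) v)) →* ℂˣ))) (m : ((UnitaryGroup.LocalRing L v)ˣ × ↥(normOneUnits (conjLocal L (IsCMField.complexConj L) v)))), toC χ m = χ.1 m.1 * χ.2 m.2) →
      -- (WM∕L2M) Weyl integration on hyperbolic support for the square-integrable classes σ ∈ supp b, `Θ_σ = D_G χ_σ|_M ∈ L¹(M)` [§12.5 p. 182; p. 193]
      (∀ σ : IrrClass (Gqs L v), b σ ≠ 0 → ∃ Θ : ((UnitaryGroup.LocalRing L v)ˣ × ↥(normOneUnits (conjLocal L (IsCMField.complexConj L) v))) → ℂ, Integrable Θ μM ∧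
          ∀ φ : Gqs L v → ℂ, IsLocSmooth φ ∧ tsupport φ ⊆ Ω → σ.smoothTrace νQv φ = ∫ m, Ftr φ m * Θ m ∂μM) →
      -- (HM) the same for the H-side `Tr St_H(ξ_v)(f^H)`, `Θ_ρ ∈ L¹(M)` [p. 193]
      (∃ Θρ : ((UnitaryGroup.LocalRing L v)ˣ × ↥(normOneUnits (conjLocal L (IsCMField.complexConj L) v))) → ℂ, Integrable Θρ μM ∧ ∀ (φ : Gqs L v → ℂ) (fH : ((UnitaryGroup.cmDatum L 2 (Matrix.of fun i j : Fin 2 => if i.val + j.val + 1 = 2 then (1 : L) else 0)).Local v × (UnitaryGroup.cmDatum L 1 (Matrix.of fun i j : Fin 1 => if i.val + j.val + 1 = 1 then (1 : L) else 0)).Local v) → ℂ), IsLocSmooth φ ∧ tsupport φ ⊆ Ω →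
          IsLocSmooth fH ∧ IsLocalDeltaTransfer L (qsForm L) v ((finExplicitCollection L (qsForm L) μ (finExplicitDelta_conj_left_all L (qsForm L) μ) (finExplicitDelta_conj_right_all L (qsForm L) μ)) v) mHv mQv fH φ → πSt.smoothTrace νHv fH = ∫ m, Ftr φ m * Θρ m ∂μM) →
      -- (PSM) van Dijk: the character of `i_G(χ)` on hyperbolic test functions is `∫_M F_φ·(χ + wχ)` [p. 193 display; vanDijk1972]
      (∀ χ : (((UnitaryGroup.LocalRing L v)ˣ →* ℂˣ) × (↥(normOneUnits (conjLocal L (IsCMField.complexConj L) v)) →* ℂˣ)), d χ ≠ 0 → ∀ φ : Gqs L v → ℂ, IsLocSmooth φ ∧ tsupport φ ⊆ Ω →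
          Representation.smoothTrace (G := Gqs L v) (UnitaryGroup.cmPrincipalSeries L 3 v (UnitaryGroup.cmTorusCharPair L v χ.1 χ.2)) νQv φ = (∫ m, Ftr φ m * (((toC χ) m : ℂˣ) : ℂ) ∂μM) + ∫ m, Ftr φ m * (((toC (conjInvChar (conjLocal L (IsCMField.complexConj L) v) χ.1, χ.2)) m : ℂˣ) : ℂ) ∂μM) →
      -- (SHF) the W-symmetrised `η`-isotypic shell functions are torus transforms of hyperbolic test functions [p. 193 «there exists a function f such that F_f(α) = φ(α) + φ(ᾱ⁻¹)»]
      (∀ χ : (((UnitaryGroup.LocalRing L v)ˣ →* ℂˣ) × (↥(normOneUnits (conjLocal L (IsCMField.complexConj L) v)) →* ℂˣ)), d χ ≠ 0 → ∀ (j : Bool) (n : ℤ), ∃ φ : Gqs L v → ℂ, (IsLocSmooth φ ∧ tsupport φ ⊆ Ω) ∧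
          Ftr φ = fun m => (((a ^ n) • (Mc : Set ((UnitaryGroup.LocalRing L v)ˣ × ↥(normOneUnits (conjLocal L (IsCMField.complexConj L) v))))).indicator (fun m => (((toC (cond j (conjInvChar (conjLocal L (IsCMField.complexConj L) v) χ.1, χ.2) χ)) a : ℂˣ) : ℂ) ^ n * ((((toC (cond j (conjInvChar (conjLocal L (IsCMField.complexConj L) v) χ.1, χ.2) χ)) m)⁻¹ : ℂˣ) : ℂ)) m) + (((a ^ n) • (Mc : Set ((UnitaryGroup.LocalRing L v)ˣ × ↥(normOneUnits (conjLocal L (IsCMField.complexConj L) v))))).indicator (fun m => (((toC (cond j (conjInvChar (conjLocal L (IsCMField.complexConj L) v) χ.1, χ.2) χ)) a : ℂˣ) : ℂ) ^ n * ((((toC (cond j (conjInvChar (conjLocal L (IsCMField.complexConj L) v) χ.1, χ.2) χ)) m)⁻¹ : ℂˣ) : ℂ)) ((Units.map ((conjLocal L (IsCMField.complexConj L) v : UnitaryGroup.LocalRing L v →+* UnitaryGroup.LocalRing L v) : UnitaryGroup.LocalRing L v →* UnitaryGroup.LocalRing L v) m.1)⁻¹, m.2))) →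
      False := by
  intro L _ _ _ μ ξ v hns hμu hμω _ _ _ _ νHv νQv _ _ _ _ mHv mQv hcanH hcanQ hTv π₁ πSt hHL hπ₁ _ _ μZ _
    𝔇 hμG hμH hμGZ hTr hρ hW hUp hρB hPCE hPCT h61a h61b h61c hHCH hUpReg hEll hDet hPiN hLds hL2domAll hUdom hsub hTell hTnon
    b d hbL2 hWred hcont hid hex hPSE _ _ _ μM _ Mc a hMc hMccpt hMcfin hMcpos hdisj hgen hωpres hωemb hωMc Ftr Ω toC htoC hWM hHM hPSM hSHF
  classical
  -- the organ's quotient σ-algebras, re-installed as local instances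
  letI : ∀ a' : ((UnitaryGroup.cmDatum L 2 (Matrix.of fun i j : Fin 2 => if i.val + j.val + 1 = 2 then (1 : L) else 0)).Local v × (UnitaryGroup.cmDatum L 1 (Matrix.of fun i j : Fin 1 => if i.val + j.val + 1 = 1 then (1 : L) else 0)).Local v), MeasurableSpace (((UnitaryGroup.cmDatum L 2 (Matrix.of fun i j : Fin 2 => if i.val + j.val + 1 = 2 then (1 : L) else 0)).Local v × (UnitaryGroup.cmDatum L 1 (Matrix.of fun i j : Fin 1 => if i.val + j.val + 1 = 1 then (1 : L) else 0)).Local v) ⧸ Subgroup.centralizer ({a'} : Set ((UnitaryGroup.cmDatum L 2 (Matrix.of fun i j : Fin 2 => if i.val + j.val + 1 = 2 then (1 : L) else 0)).Local v × (UnitaryGroup.cmDatum L 1 (Matrix.of fun i j : Fin 1 => if i.val + j.val + 1 = 1 then (1 : L) else 0)).Local v))) := fun _ => borel _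
  haveI : ∀ a' : ((UnitaryGroup.cmDatum L 2 (Matrix.of fun i j : Fin 2 => if i.val + j.val + 1 = 2 then (1 : L) else 0)).Local v × (UnitaryGroup.cmDatum L 1 (Matrix.of fun i j : Fin 1 => if i.val + j.val + 1 = 1 then (1 : L) else 0)).Local v), BorelSpace (((UnitaryGroup.cmDatum L 2 (Matrix.of fun i j : Fin 2 => if i.val + j.val + 1 = 2 then (1 : L) else 0)).Local v × (UnitaryGroup.cmDatum L 1 (Matrix.of fun i j : Fin 1 => if i.val + j.val + 1 = 1 then (1 : L) else 0)).Local v) ⧸ Subgroup.centralizer ({a'} : Set ((UnitaryGroup.cmDatum L 2 (Matrix.of fun i j : Fin 2 => if i.val + j.val + 1 = 2 then (1 : L) else 0)).Local v × (UnitaryGroup.cmDatum L 1 (Matrix.of fun i j : Fin 1 => if i.val + j.val + 1 = 1 then (1 : L) else 0)).Local v))) := fun _ => ⟨rfl⟩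
  letI : ∀ γ : Gqs L v, MeasurableSpace (Gqs L v ⧸ Subgroup.centralizer ({γ} : Set (Gqs L v))) := fun _ => borel _
  haveI : ∀ γ : Gqs L v, BorelSpace (Gqs L v ⧸ Subgroup.centralizer ({γ} : Set (Gqs L v))) := fun _ => ⟨rfl⟩
  obtain ⟨χ₀, hχ₀⟩ := hex
  -- ══ (1) `supp b` is finite: ★ K4′ on the regrouped identity, the p.s. part vanishing at pseudo-coefficients by (PSE) ══
  obtain ⟨hρm, hρli, hρst, -, hρtr⟩ := hHCH _ hρ
  obtain ⟨hUli, -⟩ := hUpReg _ hρ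
  have hx := hUdom _ hρ
  let Mt0 : (((UnitaryGroup.cmDatum L 2 (Matrix.of fun i j : Fin 2 => if i.val + j.val + 1 = 2 then (1 : L) else 0)).Local v × (UnitaryGroup.cmDatum L 1 (Matrix.of fun i j : Fin 1 => if i.val + j.val + 1 = 1 then (1 : L) else 0)).Local v) → ℂ) → (Gqs L v → ℂ) → Prop := fun fH φ => IsLocalDeltaTransfer L (qsForm L) v ((finExplicitCollection L (qsForm L) μ (finExplicitDelta_conj_left_all L (qsForm L) μ) (finExplicitDelta_conj_right_all L (qsForm L) μ)) v) mHv mQv fH φ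
  let R0 : (((UnitaryGroup.cmDatum L 2 (Matrix.of fun i j : Fin 2 => if i.val + j.val + 1 = 2 then (1 : L) else 0)).Local v × (UnitaryGroup.cmDatum L 1 (Matrix.of fun i j : Fin 1 => if i.val + j.val + 1 = 1 then (1 : L) else 0)).Local v) → ℂ) → ℂ := fun fH => ∑ σ ∈ ({πSt} : Finset (IrrClass ((UnitaryGroup.cmDatum L 2 (Matrix.of fun i j : Fin 2 => if i.val + j.val + 1 = 2 then (1 : L) else 0)).Local v × (UnitaryGroup.cmDatum L 1 (Matrix.of fun i j : Fin 1 => if i.val + j.val + 1 = 1 then (1 : L) else 0)).Local v))), σ.smoothTrace 𝔇.μH fH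
  have hMT : ∀ (fH : ((UnitaryGroup.cmDatum L 2 (Matrix.of fun i j : Fin 2 => if i.val + j.val + 1 = 2 then (1 : L) else 0)).Local v × (UnitaryGroup.cmDatum L 1 (Matrix.of fun i j : Fin 1 => if i.val + j.val + 1 = 1 then (1 : L) else 0)).Local v) → ℂ) (φ : Gqs L v → ℂ), Mt0 fH φ → 𝔇.IsTransfer φ fH := fun fH φ h => (hTr φ fH).2 h
  have hall : ∀ π : IrrClass (Gqs L v), b π ≠ 0 → 𝔇.IsL2 π := fun π h => by
    show IrrClass.IsSquareIntegrable 𝔇.μGZ π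
    rw [hμGZ]
    exact hbL2 π h
  have hTv' : ∀ (π : IrrClass (Gqs L v)) (f : Gqs L v → ℂ), 𝔇.IsL2 π → 𝔇.IsPseudoCoeff π f →
      ∃ fH : ((UnitaryGroup.cmDatum L 2 (Matrix.of fun i j : Fin 2 => if i.val + j.val + 1 = 2 then (1 : L) else 0)).Local v × (UnitaryGroup.cmDatum L 1 (Matrix.of fun i j : Fin 1 => if i.val + j.val + 1 = 1 then (1 : L) else 0)).Local v) → ℂ, IsLocSmooth fH ∧ Mt0 fH f := fun π f _ hf => hTv f ⟨hf.1.1, hf.1.2⟩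
  have hid' : ∀ (π₀ : IrrClass (Gqs L v)) (fH : ((UnitaryGroup.cmDatum L 2 (Matrix.of fun i j : Fin 2 => if i.val + j.val + 1 = 2 then (1 : L) else 0)).Local v × (UnitaryGroup.cmDatum L 1 (Matrix.of fun i j : Fin 1 => if i.val + j.val + 1 = 1 then (1 : L) else 0)).Local v) → ℂ) (f : Gqs L v → ℂ), 𝔇.IsL2 π₀ → 𝔇.IsPseudoCoeff π₀ f → IsLocSmooth fH → Mt0 fH f →
      Summable (fun π : IrrClass (Gqs L v) => (b π : ℂ) * π.smoothTrace 𝔇.μG f) ∧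
        ∑' π : IrrClass (Gqs L v), (b π : ℂ) * π.smoothTrace 𝔇.μG f = R0 fH := by
    intro π₀ fH f hπ₀ hf hfH hm
    obtain ⟨hsb, -, heq⟩ := hid fH f hfH ⟨hf.1.1, hf.1.2⟩ hm
    have hps0 : ∑' χ : (((UnitaryGroup.LocalRing L v)ˣ →* ℂˣ) × (↥(normOneUnits (conjLocal L (IsCMField.complexConj L) v)) →* ℂˣ)), (d χ : ℂ) * Representation.smoothTrace (G := Gqs L v) (UnitaryGroup.cmPrincipalSeries L 3 v (UnitaryGroup.cmTorusCharPair L v χ.1 χ.2)) νQv f = 0 := by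
      refine (tsum_congr fun χ => ?_).trans tsum_zero
      by_cases hχ : d χ = 0
      · rw [hχ, Int.cast_zero, zero_mul]
      · rw [hPSE π₀ f hπ₀ hf χ hχ, mul_zero]
    rw [hps0, add_zero] at heq
    rw [hμG]
    refine ⟨hsb, ?_⟩
    rw [heq]
    show πSt.smoothTrace νHv fH = ∑ σ ∈ ({πSt} : Finset (IrrClass ((UnitaryGroup.cmDatum L 2 (Matrix.of fun i j : Fin 2 => if i.val + j.val + 1 = 2 then (1 : L) else 0)).Local v × (UnitaryGroup.cmDatum L 1 (Matrix.of fun i j : Fin 1 => if i.val + j.val + 1 = 1 then (1 : L) else 0)).Local v))), σ.smoothTrace 𝔇.μH fH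
    rw [Finset.sum_singleton, hμH]
  have hup : ∀ (π : IrrClass (Gqs L v)) (f : Gqs L v → ℂ) (fH : ((UnitaryGroup.cmDatum L 2 (Matrix.of fun i j : Fin 2 => if i.val + j.val + 1 = 2 then (1 : L) else 0)).Local v × (UnitaryGroup.cmDatum L 1 (Matrix.of fun i j : Fin 1 => if i.val + j.val + 1 = 1 then (1 : L) else 0)).Local v) → ℂ),
      𝔇.IsPseudoCoeff π f → 𝔇.IsTransfer f fH → IsLocSmooth fH → R0 fH = 𝔇.innerG (𝔇.up (𝔇.packetCharH {πSt})) (𝔇.char π) :=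
    fun π f fH hf htr hfH =>
      F0P3cStCharTSUpPseudo.packetTrace_transfer_eq_innerG_up_LB 𝔇 hW hUp hsub hTell hTnon {πSt} hρm hρli hρst hρtr hρB hUli hx (hL2domAll π) hf hfH htr
  have hbfin : (Function.support b).Finite :=
    F0P3cStCharTSFinOfL2Pseudo.support_finite_of_members_isL2_pseudo 𝔇 hTell hEll
      (fun π π' hp hπ => F0P3cStCharTSFinOfL2.not_isL2_of_isEllipticPair 𝔇 hDet hPiN hLds π π' hp hπ) (fun π _ => hL2domAll π)
      hPCE hPCT h61a h61b h61c IsLocSmooth Mt0 R0 hTv' hMT b hall hid' _ hx hup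
  -- ══ (2) the torus instantiation of ★ «Sa-TORUS-GENERIC» ══
  let ω : ((UnitaryGroup.LocalRing L v)ˣ × ↥(normOneUnits (conjLocal L (IsCMField.complexConj L) v))) → ((UnitaryGroup.LocalRing L v)ˣ × ↥(normOneUnits (conjLocal L (IsCMField.complexConj L) v))) := fun p => ((Units.map ((conjLocal L (IsCMField.complexConj L) v : UnitaryGroup.LocalRing L v →+* UnitaryGroup.LocalRing L v) : UnitaryGroup.LocalRing L v →* UnitaryGroup.LocalRing L v) p.1)⁻¹, p.2)
  let w : (((UnitaryGroup.LocalRing L v)ˣ →* ℂˣ) × (↥(normOneUnits (conjLocal L (IsCMField.complexConj L) v)) →* ℂˣ)) → (((UnitaryGroup.LocalRing L v)ˣ →* ℂˣ) × (↥(normOneUnits (conjLocal L (IsCMField.complexConj L) v)) →* ℂˣ)) := fun χ => (conjInvChar (conjLocal L (IsCMField.complexConj L) v) χ.1, χ.2)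
  have hσσ : ∀ x : (UnitaryGroup.LocalRing L v)ˣ, Units.map ((conjLocal L (IsCMField.complexConj L) v : UnitaryGroup.LocalRing L v →+* UnitaryGroup.LocalRing L v) : UnitaryGroup.LocalRing L v →* UnitaryGroup.LocalRing L v) (Units.map ((conjLocal L (IsCMField.complexConj L) v : UnitaryGroup.LocalRing L v →+* UnitaryGroup.LocalRing L v) : UnitaryGroup.LocalRing L v →* UnitaryGroup.LocalRing L v) x) = x := fun x => by
    apply Units.ext
    simp only [Units.coe_map, MonoidHom.coe_coe]
    exact conjLocal_conjLocal_cm L v _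
  have hωω : ∀ m, ω (ω m) = m := fun m => by
    ext1
    · show (Units.map ((conjLocal L (IsCMField.complexConj L) v : UnitaryGroup.LocalRing L v →+* UnitaryGroup.LocalRing L v) : UnitaryGroup.LocalRing L v →* UnitaryGroup.LocalRing L v) ((Units.map ((conjLocal L (IsCMField.complexConj L) v : UnitaryGroup.LocalRing L v →+* UnitaryGroup.LocalRing L v) : UnitaryGroup.LocalRing L v →* UnitaryGroup.LocalRing L v) m.1)⁻¹))⁻¹ = m.1
      rw [map_inv, inv_inv, hσσ]
    · rfl
  have hww : ∀ χ, w (w χ) = χ := fun χ => by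
    ext1
    · show conjInvChar (conjLocal L (IsCMField.complexConj L) v) (conjInvChar (conjLocal L (IsCMField.complexConj L) v) χ.1) = χ.1
      ext x
      rw [conjInvChar_apply, conjInvChar_apply, inv_inv, hσσ]
    · rfl
  have hwχ : ∀ χ m, toC (w χ) m = toC χ (ω m) := fun χ m => by
    rw [htoC, htoC]
    show conjInvChar (conjLocal L (IsCMField.complexConj L) v) χ.1 m.1 * χ.2 m.2 = χ.1 (Units.map ((conjLocal L (IsCMField.complexConj L) v : UnitaryGroup.LocalRing L v →+* UnitaryGroup.LocalRing L v) : UnitaryGroup.LocalRing L v →* UnitaryGroup.LocalRing L v) m.1)⁻¹ * χ.2 m.2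
    rw [conjInvChar_apply, map_inv]
  have htc : Function.Injective toC := by
    intro χ χ' h
    ext1
    · refine MonoidHom.ext fun x => ?_
      have := DFunLike.congr_fun h (x, 1)
      rw [htoC, htoC] at this
      simpa using this
    · refine MonoidHom.ext fun y => ?_
      have := DFunLike.congr_fun h (1, y)
      rw [htoC, htoC] at this
      simpa using this
  have hWred' : ∀ χ χ', d χ ≠ 0 → d χ' ≠ 0 → χ' = w χ → χ' = χ := fun χ χ' hχ hχ' e =>
    hWred χ χ' hχ hχ' (by rw [e]) (by rw [e])
  have hreg : ∀ χ, d χ ≠ 0 → (Measurable fun m => ((toC χ m : ℂˣ) : ℂ)) ∧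
      ∃ Cb : ℝ, ∀ u ∈ Mc, ‖((toC χ u : ℂˣ) : ℂ)‖ ≤ Cb ∧ ‖(((toC χ u)⁻¹ : ℂˣ) : ℂ)‖ ≤ Cb := by
    intro χ hχ
    obtain ⟨hc1, hc2⟩ := hcont χ hχ
    have hf : Continuous fun m : ((UnitaryGroup.LocalRing L v)ˣ × ↥(normOneUnits (conjLocal L (IsCMField.complexConj L) v))) => ((toC χ m : ℂˣ) : ℂ) := by
      have : (fun m : ((UnitaryGroup.LocalRing L v)ˣ × ↥(normOneUnits (conjLocal L (IsCMField.complexConj L) v))) => ((toC χ m : ℂˣ) : ℂ)) = fun m => ((χ.1 m.1 : ℂˣ) : ℂ) * ((χ.2 m.2 : ℂˣ) : ℂ) := by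
        funext m; rw [htoC, Units.val_mul]
      rw [this]
      exact (Units.continuous_val.comp (hc1.comp continuous_fst)).mul (Units.continuous_val.comp (hc2.comp continuous_snd))
    have hg : Continuous fun m : ((UnitaryGroup.LocalRing L v)ˣ × ↥(normOneUnits (conjLocal L (IsCMField.complexConj L) v))) => (((toC χ m)⁻¹ : ℂˣ) : ℂ) := by
      have : (fun m : ((UnitaryGroup.LocalRing L v)ˣ × ↥(normOneUnits (conjLocal L (IsCMField.complexConj L) v))) => (((toC χ m)⁻¹ : ℂˣ) : ℂ)) = fun m => (((toC χ m : ℂˣ) : ℂ))⁻¹ := by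
        funext m; rw [Units.val_inv_eq_inv_val]
      rw [this]
      exact hf.inv₀ fun m => Units.ne_zero _
    obtain ⟨C1, hC1⟩ := hMccpt.exists_bound_of_continuousOn hf.continuousOn
    obtain ⟨C2, hC2⟩ := hMccpt.exists_bound_of_continuousOn hg.continuousOn
    exact ⟨hf.measurable, max C1 C2, fun u hu => ⟨(hC1 u hu).trans (le_max_left _ _), (hC2 u hu).trans (le_max_right _ _)⟩⟩
  have hT' : ∀ φ : Gqs L v → ℂ, (IsLocSmooth φ ∧ tsupport φ ⊆ Ω) → ∃ fH : ((UnitaryGroup.cmDatum L 2 (Matrix.of fun i j : Fin 2 => if i.val + j.val + 1 = 2 then (1 : L) else 0)).Local v × (UnitaryGroup.cmDatum L 1 (Matrix.of fun i j : Fin 1 => if i.val + j.val + 1 = 1 then (1 : L) else 0)).Local v) → ℂ, IsLocSmooth fH ∧ Mt0 fH φ := by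
    intro φ hφ
    obtain ⟨fH, h1, h2⟩ := hTv φ hφ.1
    exact ⟨fH, h1, h2⟩
  have hid'' : ∀ (fH : ((UnitaryGroup.cmDatum L 2 (Matrix.of fun i j : Fin 2 => if i.val + j.val + 1 = 2 then (1 : L) else 0)).Local v × (UnitaryGroup.cmDatum L 1 (Matrix.of fun i j : Fin 1 => if i.val + j.val + 1 = 1 then (1 : L) else 0)).Local v) → ℂ) (φ : Gqs L v → ℂ), (IsLocSmooth φ ∧ tsupport φ ⊆ Ω) → (IsLocSmooth fH ∧ Mt0 fH φ) →
      Summable (fun π : IrrClass (Gqs L v) => (b π : ℂ) * π.smoothTrace νQv φ) ∧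
      Summable (fun χ : (((UnitaryGroup.LocalRing L v)ˣ →* ℂˣ) × (↥(normOneUnits (conjLocal L (IsCMField.complexConj L) v)) →* ℂˣ)) => (d χ : ℂ) * Representation.smoothTrace (G := Gqs L v) (UnitaryGroup.cmPrincipalSeries L 3 v (UnitaryGroup.cmTorusCharPair L v χ.1 χ.2)) νQv φ) ∧
      ∑' π : IrrClass (Gqs L v), (b π : ℂ) * π.smoothTrace νQv φ + ∑' χ : (((UnitaryGroup.LocalRing L v)ˣ →* ℂˣ) × (↥(normOneUnits (conjLocal L (IsCMField.complexConj L) v)) →* ℂˣ)), (d χ : ℂ) * Representation.smoothTrace (G := Gqs L v) (UnitaryGroup.cmPrincipalSeries L 3 v (UnitaryGroup.cmTorusCharPair L v χ.1 χ.2)) νQv φ = πSt.smoothTrace νHv fH :=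
    fun fH φ hφ hm => hid fH φ hm.1 hφ.1 hm.2
  exact F0P3cStCharTSSaTorusGeneric.false_of_ps_expansion μM Mc hMc hMcfin hMcpos a hdisj hgen ω hωpres hωemb hωω hωMc toC htc w hww hwχ
    Ftr (fun φ => IsLocSmooth φ ∧ tsupport φ ⊆ Ω) (fun σ φ => σ.smoothTrace νQv φ)
    (fun χ φ => Representation.smoothTrace (G := Gqs L v) (UnitaryGroup.cmPrincipalSeries L 3 v (UnitaryGroup.cmTorusCharPair L v χ.1 χ.2)) νQv φ) (fun fH => πSt.smoothTrace νHv fH) (fun fH φ => IsLocSmooth fH ∧ Mt0 fH φ)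
    hT' b hbfin d hWred' hid'' hWM hHM hPSM hSHF hreg ⟨χ₀, hχ₀⟩

end Summit.HodgeConjecture.HodgeConjecture.Cruxes.H413.F0P3cStCharTSSaTorusLB

end
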